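import Literature.MathematicalPhysics.QuantumFieldTheory.StrongCouplingClustering
import Literature.MathematicalPhysics.QuantumFieldTheory.Sweep1AreaLawProofs
import Literature.MathematicalPhysics.QuantumFieldTheory.UnitaryTraceConcentration
import Literature.MathematicalPhysics.QuantumFieldTheory.UnitaryHaarVolume
import Literature.MathematicalPhysics.QuantumFieldTheory.ChatterjeeFreeEnergyJointLimit
import Literature.MathematicalPhysics.QuantumFieldTheory.LatticeMaxwellFreeEnergyLimit
import HarnessLib

/-!
# Chatterjee's leading term of the Yang–Mills free energy: the discharge of `chatterjee_freeEnergy`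

Sibling proof file of `Literature/MathematicalPhysics/QuantumFieldTheory/Sweep1.lean`
(constructive-qft.S17). It proves, sorry-free and without introducing any named fact,

  `theorem chatterjee_freeEnergy_holds : chatterjee_freeEnergy`,

S. Chatterjee, *The leading term of the Yang–Mills free energy*, J. Funct. Anal. 271 (2016)
2944–3005, arXiv:1602.01222, **Theorem 2.1**: for every `d ≥ 2` there is `K_d` such that for every
`N ≥ 1` and every unitary model `ρ : G →* M_N(ℂ)` (`IsUnitaryModel ρ`: `G ≅ U(N)` onto its defining
representation), jointly as `n → ∞` and `β = 1/g₀² → ∞`,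
`F(B_n, β) + ½(d - 1 - d/n + 1/n^d) N² log β → (d-1) log(∏_{j=1}^{N-1} j!/(2π)^{N/2}) + N² K_d`.

Assembly of the printed proof (§§6–17), all of whose steps are in the tree:

* `ChatterjeeJointLimit.tendsto_freeEnergyPerSite_of_tendsto_logZM` (`ChatterjeeFreeEnergyJointLimit`,
  on top of `UnitaryCayleyChart`, `LatticeAxialGauge`, `WilsonWeakCouplingBounds`, `GaussianToolkit`,
  `LatticeMaxwellGaussian`, `LatticeMaxwellMultiscale`, `ChatterjeeScaleComparison`,
  `ChatterjeeGaussianFactorisation`, `ChatterjeeFreeEnergyBounds`): §§7–14, 16, 17 — the joint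
  limit for `U(N)` with the soft Haar constant `c_N = haarChartConst N`, modulo Theorem 15.2;
* `LatticeMaxwell.tendsto_logZM_div` (`LatticeMaxwellFreeEnergyLimit`): §15, Theorem 15.2, the
  existence of `L_d = lim log Z_M(B_n)/n^d`; we take `K_d = L_d - ((d-1)/2) log(2π)`;
* `UnitaryColumn.log_haarChartConst_add` (`UnitaryHaarVolume`, on top of `UnitaryColumnFibration`,
  `UnitaryColumnLaw`, `UnitaryChartTransition`): §6 and Thm. 11.1, the value of the constant,
  `log c_N + (N²/2) log(2π) = log(∏_{j<N} j!/(2π)^{N/2})`;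
* `UnitaryModel.freeEnergyPerSite_eq` (this file): transport of the free energy per site along the
  isomorphism `G ≃* U(N)` of a unitary model (push-forward of the infinite product Haar measure),
  reducing arbitrary unitary models to the defining representation of `Matrix.unitaryGroup (Fin N) ℂ`;
* `chatterjee_freeEnergy_of` (this file): the elementary bookkeeping of constants.

As a corollary, the sibling named fact `chatterjee_freeEnergyDensity` of `LatticeGaugeAsymptotics`
(the torus normalisation) is discharged too (`chatterjee_freeEnergyDensity_holds`), through the
reduction `chatterjee_freeEnergyDensity_of` of `LatticeGaugeAsymptoticsFreeEnergyProofs`.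

## References

* S. Chatterjee, *The leading term of the Yang–Mills free energy*, J. Funct. Anal. 271 (2016)
  2944–3005, arXiv:1602.01222, Thm. 2.1 and §§6–17. [arXiv160201222]
-/

noncomputable section

open MeasureTheory Measure Filter Topology
open scoped ENNReal Real NNReal
open Literature.MathematicalPhysics.QuantumLattice (unitaryFundamentalRep)
open Literature.Probability.LatticeModels (halfOpenBox)


namespace Literature.MathematicalPhysics.QuantumFieldTheory

namespace UnitaryModel


variable {N : ℕ} {G : Type*} [Group G] [TopologicalSpace G] {ρ : G →* Matrix (Fin N) (Fin N) ℂ}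

/-- The isomorphism `G ≃* U(N)` of a unitary model, as a monoid hom. [folklore] -/
def toUnitaryHom (hρ : IsUnitaryModel ρ) : G →* Matrix.unitaryGroup (Fin N) ℂ where
  toFun g := ⟨ρ g, IsUnitaryModel.mem_unitaryGroup ρ hρ g⟩
  map_one' := Subtype.ext (by simp)
  map_mul' g h := Subtype.ext (by simp)

/-- Underlying matrix of `toUnitaryHom`. [folklore] -/
@[simp] theorem coe_toUnitaryHom (hρ : IsUnitaryModel ρ) (g : G) :
    ((toUnitaryHom hρ g : Matrix.unitaryGroup (Fin N) ℂ) : Matrix (Fin N) (Fin N) ℂ) = ρ g := rfl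

/-- `toUnitaryHom` is bijective. [folklore] -/
theorem bijective_toUnitaryHom (hρ : IsUnitaryModel ρ) : Function.Bijective (toUnitaryHom hρ) := by
  refine ⟨fun g h hgh => hρ.2.1 (by simpa using congrArg Subtype.val hgh), fun U => ?_⟩
  obtain ⟨g, hg⟩ := IsUnitaryModel.exists_eq ρ hρ U.2
  exact ⟨g, Subtype.ext hg⟩

/-- **The isomorphism `G ≃* U(N)` of a unitary model.** [folklore] -/
def equiv (hρ : IsUnitaryModel ρ) : G ≃* Matrix.unitaryGroup (Fin N) ℂ :=
  MulEquiv.ofBijective (toUnitaryHom hρ) (bijective_toUnitaryHom hρ)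

/-- Underlying matrix of `equiv`. [folklore] -/
@[simp] theorem coe_equiv (hρ : IsUnitaryModel ρ) (g : G) :
    ((equiv hρ g : Matrix.unitaryGroup (Fin N) ℂ) : Matrix (Fin N) (Fin N) ℂ) = ρ g := rfl

/-- `equiv` is continuous. [folklore] -/
theorem continuous_equiv (hρ : IsUnitaryModel ρ) : Continuous (equiv hρ) :=
  Continuous.subtype_mk hρ.1 _

section Compact

variable [CompactSpace G]

/-- `equiv` is a homeomorphism (a continuous bijection from a compact space to a Hausdorff space). [folklore] -/
def homeo (hρ : IsUnitaryModel ρ) : G ≃ₜ Matrix.unitaryGroup (Fin N) ℂ :=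
  Continuous.homeoOfEquivCompactToT2 (f := (equiv hρ).toEquiv) (continuous_equiv hρ)

/-- `homeo` is `equiv` as a function. [folklore] -/
@[simp] theorem coe_homeo (hρ : IsUnitaryModel ρ) : ⇑(homeo hρ) = equiv hρ := rfl

end Compact

section Config

variable {d : ℕ}

/-- The induced map of configurations. [folklore] -/
def configMap (hρ : IsUnitaryModel ρ) (U : ZdGaugeConfig d G) : ZdGaugeConfig d (Matrix.unitaryGroup (Fin N) ℂ) :=
  fun e => equiv hρ (U e)

/-- Plaquette holonomies are transported by the group isomorphism. [folklore] -/
theorem plaquette_configMap (hρ : IsUnitaryModel ρ) (U : ZdGaugeConfig d G)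
    (x : Literature.Probability.LatticeModels.Site d) (i j : Fin d) :
    (configMap hρ U).plaquette x i j = equiv hρ (U.plaquette x i j) := by
  simp [ZdGaugeConfig.plaquette, configMap, map_mul, map_inv]

/-- The Wilson action is transported: `S_ρ(U) = S_{U(N)}(φ ∘ U)`. [folklore] -/
theorem zdWilsonAction_configMap (hρ : IsUnitaryModel ρ) (Λ : Finset (Literature.Probability.LatticeModels.Site d))
    (U : ZdGaugeConfig d G) :
    zdWilsonAction (unitaryFundamentalRep (Fin N) ℂ) Λ (configMap hρ U) = zdWilsonAction ρ Λ U := by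
  unfold zdWilsonAction
  refine Finset.sum_congr rfl fun p _ => ?_
  rw [plaquette_configMap]
  rfl

end Config

section Measure

variable [IsTopologicalGroup G] [CompactSpace G] [MeasurableSpace G] [BorelSpace G] {d : ℕ}

omit [IsTopologicalGroup G] [CompactSpace G] in
/-- `configMap` is measurable. [folklore] -/
theorem measurable_configMap (hρ : IsUnitaryModel ρ) : Measurable (configMap (d := d) hρ) :=
  measurable_pi_lambda _ fun e => (continuous_equiv hρ).measurable.comp (measurable_pi_apply e)

/-- **Haar measure is transported**: `equiv_* (Haar_G) = Haar_{U(N)}`. [folklore] -/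
theorem map_equiv_haarProbability (hρ : IsUnitaryModel ρ) :
    (haarProbability G).map (equiv hρ) = haarProbability (Matrix.unitaryGroup (Fin N) ℂ) := by
  set φ := equiv hρ with hφ
  have hmeas : Measurable φ := (continuous_equiv hρ).measurable
  set μ := (haarProbability G).map φ with hμ
  haveI : IsProbabilityMeasure μ := Measure.isProbabilityMeasure_map hmeas.aemeasurable
  haveI : μ.IsMulLeftInvariant := by
    refine ⟨fun U => ?_⟩
    obtain ⟨g, rfl⟩ := (bijective_toUnitaryHom hρ).2 U
    change Measure.map (fun x => φ g * x) μ = μ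
    rw [hμ, Measure.map_map (measurable_const_mul _) hmeas]
    have : (fun x => φ g * x) ∘ φ = φ ∘ fun x => g * x := by funext x; simp
    rw [this, ← Measure.map_map hmeas (measurable_const_mul g), map_mul_left_eq_self]
  have h := Measure.haarMeasure_unique μ (⊤ : TopologicalSpace.PositiveCompacts (Matrix.unitaryGroup (Fin N) ℂ))
  rw [h, TopologicalSpace.PositiveCompacts.coe_top, measure_univ, one_smul]
  rfl

/-- **The product Haar measure is transported**: `configMap_* dg_∞^G = dg_∞^{U(N)}`. [folklore] -/
theorem map_configMap_zdHaar (hρ : IsUnitaryModel ρ) :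
    (zdHaar d G).map (configMap hρ) = zdHaar d (Matrix.unitaryGroup (Fin N) ℂ) := by
  have hc : (configMap (d := d) hρ) = fun U (e : ZdEdge d) => (fun (_ : ZdEdge d) (g : G) => equiv hρ g) e (U e) := rfl
  rw [zdHaar, zdHaar, hc,
    Measure.infinitePi_map_pi (μ := fun _ : ZdEdge d => haarProbability G) (fun _ => (continuous_equiv hρ).measurable)]
  simp only [map_equiv_haarProbability]

/-- **The partition function of a unitary model is that of `U(N)`**: `Z_ρ(Λ, β) = Z_{U(N)}(Λ, β)`. [folklore] -/
theorem zdPartitionFunction_eq (hρ : IsUnitaryModel ρ) (β : ℝ) (Λ : Finset (Literature.Probability.LatticeModels.Site d)) :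
    zdPartitionFunction (d := d) ρ β Λ = zdPartitionFunction (d := d) (unitaryFundamentalRep (Fin N) ℂ) β Λ := by
  rw [zdPartitionFunction_eq_lintegral, zdPartitionFunction_eq_lintegral, ← map_configMap_zdHaar hρ,
    lintegral_map _ (measurable_configMap hρ)]
  · simp only [zdWilsonAction_configMap]
  · have hc : Continuous (unitaryFundamentalRep (Fin N) ℂ) := continuous_subtype_val
    exact ENNReal.measurable_ofReal.comp (Real.measurable_exp.comp
      ((AreaLaw.continuous_zdWilsonAction (unitaryFundamentalRep (Fin N) ℂ) hc Λ).measurable.const_mul _))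

/-- **The free energy per site of a unitary model is that of `U(N)`.** [folklore] -/
theorem freeEnergyPerSite_eq (hρ : IsUnitaryModel ρ) (β : ℝ) (Λ : Finset (Literature.Probability.LatticeModels.Site d)) :
    freeEnergyPerSite (d := d) ρ β Λ = freeEnergyPerSite (d := d) (unitaryFundamentalRep (Fin N) ℂ) β Λ := by
  rw [freeEnergyPerSite, freeEnergyPerSite, zdPartitionFunction_eq hρ]

end Measure

end UnitaryModel





/-- **Reduction of Chatterjee's Theorem 2.1 to the concrete group `U(N)` with the soft Haar
constant.** If, for every `d ≥ 2`, there is `K = K_d` such that for every `N ≥ 1` the free energy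
per site of `U(N)` lattice gauge theory (defining representation) on the cubes `B_n` satisfies the
joint limit of Theorem 2.1 with the constant written as `(d-1)(log c_N + (N²/2) log 2π) + N² K`,
`c_N = haarChartConst N` the Haar density constant of the Cayley chart, then the named fact
`chatterjee_freeEnergy` (arbitrary unitary models, Chatterjee's explicit constant
`(d-1) log(∏_{j<N} j!/(2π)^{N/2}) + N² K`) holds: transport along `G ≅ U(N)`
(`UnitaryModel.freeEnergyPerSite_eq`) and the value of `c_N`
(`UnitaryColumn.log_haarChartConst_add`, Chatterjee's Thm. 6.1/11.1). [cite: arXiv160201222, Thm. 2.1] -/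
theorem chatterjee_freeEnergy_of
    (h : ∀ d : ℕ, 2 ≤ d → ∃ K : ℝ, ∀ N : ℕ, 1 ≤ N →
      Tendsto
        (fun p : ℕ × ℝ =>
          freeEnergyPerSite (unitaryFundamentalRep (Fin N) ℂ) p.2 (halfOpenBox d p.1) +
            (1 / 2) * ((d : ℝ) - 1 - d / p.1 + 1 / (p.1 : ℝ) ^ d) * (N : ℝ) ^ 2 * Real.log p.2)
        (atTop ×ˢ atTop)
        (𝓝 (((d : ℝ) - 1) * (Real.log (UnitaryCayley.haarChartConst N) + (N : ℝ) ^ 2 / 2 * Real.log (2 * π)) +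
          (N : ℝ) ^ 2 * K))) :
    chatterjee_freeEnergy := by
  intro d hd
  obtain ⟨K, hK⟩ := h d hd
  refine ⟨K, fun N hN G _ _ _ _ _ _ ρ hρ => ?_⟩
  have hlim := hK N hN
  rw [UnitaryColumn.log_haarChartConst_add] at hlim
  have hfun : (fun p : ℕ × ℝ =>
      freeEnergyPerSite ρ p.2 (halfOpenBox d p.1) +
        (1 / 2) * ((d : ℝ) - 1 - d / p.1 + 1 / (p.1 : ℝ) ^ d) * (N : ℝ) ^ 2 * Real.log p.2) =
      (fun p : ℕ × ℝ =>
        freeEnergyPerSite (unitaryFundamentalRep (Fin N) ℂ) p.2 (halfOpenBox d p.1) +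
          (1 / 2) * ((d : ℝ) - 1 - d / p.1 + 1 / (p.1 : ℝ) ^ d) * (N : ℝ) ^ 2 * Real.log p.2) := by
    funext p
    rw [UnitaryModel.freeEnergyPerSite_eq hρ]
  rw [hfun]
  convert hlim using 3





/-- **Chatterjee's Theorem 2.1** (the leading term of the Yang–Mills free energy), discharging the
named fact `chatterjee_freeEnergy` of `Sweep1`: for every `d ≥ 2`, with
`K_d = lim_n log Z_M(B_n)/n^d - ((d-1)/2) log(2π)` (Theorem 15.2), every `N ≥ 1` and every unitary
model, jointly as `n → ∞`, `β → ∞`,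
`F(B_n, β) + ½(d-1-d/n+1/n^d)N² log β → (d-1) log(∏_{j<N} j!/(2π)^{N/2}) + N² K_d`. [cite: arXiv160201222, Thm. 2.1] -/
theorem chatterjee_freeEnergy_holds : chatterjee_freeEnergy := by
  refine chatterjee_freeEnergy_of fun d hd => ?_
  have hd1 : 1 ≤ d := by omega
  obtain ⟨L, hL⟩ := LatticeMaxwell.tendsto_logZM_div (d := d) hd1
  refine ⟨L - ((d : ℝ) - 1) / 2 * Real.log (2 * π), fun N hN => ?_⟩
  have h := ChatterjeeJointLimit.tendsto_freeEnergyPerSite_of_tendsto_logZM (d := d) (N := N) hd hN hL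
  convert h using 2
  ring

/-- **constructive-qft.S17 in the torus normalisation** (the named fact `chatterjee_freeEnergyDensity`
of `LatticeGaugeAsymptotics`: existence of the torus free energy density of `U(N)` lattice gauge
theory on `ℤ⁴` and `f(β) - c log β → K`), discharged through the reduction
`chatterjee_freeEnergyDensity_of` of `LatticeGaugeAsymptoticsFreeEnergyProofs` applied to
Theorem 2.1. [cite: arXiv160201222, Thm. 2.1] -/
theorem chatterjee_freeEnergyDensity_holds : chatterjee_freeEnergyDensity :=
  chatterjee_freeEnergyDensity_of chatterjee_freeEnergy_holds

end Literature.MathematicalPhysics.QuantumFieldTheory
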